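import Summits.BirchSwinnertonDyer.BirchSwinnertonDyer.Theorems.GoldfeldAllTwistsTwoConverseTwinQuarterTraceRelationsQP
import Summits.BirchSwinnertonDyer.BirchSwinnertonDyer.Theorems.GoldfeldAllTwistsTwoConverseTwinQuarterTracePartnerEHeight
import Summits.BirchSwinnertonDyer.BirchSwinnertonDyer.Theorems.GoldfeldAllTwistsTwoConverseTwinQuarterTraceGenusE
import Summits.BirchSwinnertonDyer.BirchSwinnertonDyer.Theorems.GoldfeldAllTwistsTwoConverseTwinQuarterTraceCoreSubgroup
import HarnessLib

set_option linter.dupNamespace false -- namespace `…BirchSwinnertonDyer.BirchSwinnertonDyer…` is the cell's (D-0017 nested layout)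
set_option autoImplicit false

/-!
# LINE C3⁺ (PHASE 2), file P2g-2: the `χ_e` RELATION — collinearity `M₁•P_e = (2m₁)•Y_e + t₁` in `X₀(49)(K[1])`, the partner
# field's genus relation `M′•P′ = 4•(k′•Y′) + t′` in `X₀(49)(ℚ(√−qp)[1])`, and the abstract combination `M_e•P_e = 4•R_e + t_e`, `(1+c)R_e = T`

Cell `bsd-goldfeld`, seat `bsd-goldfeld-s1p-c3x` (gen 7); planner ORDER (ccxxix)/(ccxxxi) «LINE C3⁺», assembly part 2 (memo §5′ P2e/P2g).
`--supports stmt-BirchSwinnertonDyer-20044` as a HELPER. Theses-free; theorems only; no definition, no `sorry`, no new fact; the ONE binder is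
CLTZ Thm 1.4 (`h14`, at `(l₀,R₁,N) = (q,1,p)` through P2e-1's `rankOne_negTwoPrimesTwist_of_thm14`, with `hNo4` literal). Everything else
enters as hypotheses in the shape the landed files deliver (heights P2e-1 / P2e-4′, partner points P2e-2 / A″, half-trace law P2e-3).

* §1 `chiE_relation_of_genusStep` (abstract group algebra): from `M₁•P_e = (2m₁)•Y_e + t₁`, `Y_e = s•(2Φ − P′)`, `cΦ + Φ = κ′T`,
  `M′•P′ = 4•(k′•Y′) + t′`, `cY′ + Y′ = T` with `M₁, m₁, M′, s, κ′` ODD: `M_e•P_e = 4•R_e + t_e` with `R_e := (m₁sM′)•Φ − (2m₁sk′)•Y′ ∈ B`,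
  `(1+c)R_e = T` (`ε_e = 1`), `t_e` torsion in `B`.
* §2 `exists_halfTrace_relation_e`: `∃ M₁ m₁ t₁`, `M₁, m₁` odd, `t₁` torsion, `M₁•P_e = (2m₁)•Y_e + t₁` — P2-G configuration (a) with `d = −qp`
  (`rank 49a1^{(−qp)}(ℚ) = 1` by CLTZ 1.4 at `(q,1,p)`; `(49a1^{(−qp)})^{(d_K)} ≅ 49a1^{(2)}` torsion, A″'s fact-free lemma at `l = qp`) + P2e-1's
  ratio `4ρ` + A″'s collinearity algebra.
* §3 `exists_genus_relation_prime`: over the partner field `F = ℚ(√−qp)`: `∃ M′ k′ t′`, `M′` odd, `t′` torsion, `M′•P′ = 4•(k′•Y′) + t′` —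
  P2-G configuration (b) over `F` with `d = p` + P2e-4′'s ratio `x` + §1 of P2g-1.
HONEST FRAMING: descent/height algebra; no case of K12₂″ / twin″ decided; BSD is not proved by any of this.

References: [CoatesLiTianZhai2015] Thm 1.3, 1.4, (2.8); [CaiShuTian2014] Thm 1.1; [SilvermanAEC2009] VIII.9.3, X.2; [Gross1984] §§4–5;
[GrossLMS1991] Prop. 5.3. -/

noncomputable section

open scoped Classical IntermediateField

open WeierstrassCurve Literature.NumberTheory.EllipticCurves Literature.NumberTheory.EllipticCurves.ModularForms
  Literature.NumberTheory.EllipticCurves.CoatesLiTianZhai2015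

namespace Summit.BirchSwinnertonDyer.BirchSwinnertonDyer.Theorems.GoldfeldGoodTwists

/-! ## §1 The abstract combination -/

section Abstract

variable {M : Type*} [AddCommGroup M]

/-- **The `χ_e` relation from the genus step (pure algebra).** See the module docstring. [cite: GrossLMS1991, Prop. 5.3] [cite: CoatesLiTianZhai2015, Thm. 2.5] -/
theorem chiE_relation_of_genusStep (c : M →+ M) (B : AddSubgroup M) {T Pe Ye Φ P' Y' t₁ t' : M}
    {M₁ m₁ M' k' s κ' : ℤ} (hM₁ : Odd M₁) (hm₁ : Odd m₁) (hM' : Odd M') (hs : Odd s) (hκ' : Odd κ') (hT2 : 2 • T = 0)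
    (h1 : M₁ • Pe = (2 * m₁) • Ye + t₁) (h2 : Ye = s • ((2 : ℤ) • Φ - P'))
    (h3 : c Φ + Φ = κ' • T) (h4 : M' • P' = (4 : ℤ) • (k' • Y') + t') (h5 : c Y' + Y' = T)
    (hΦB : Φ ∈ B) (hY'B : Y' ∈ B) (ht₁B : t₁ ∈ B) (ht'B : t' ∈ B) (ht₁ : IsOfFinAddOrder t₁) (ht' : IsOfFinAddOrder t') :
    ∃ (Me : ℤ) (Re te : M), Odd Me ∧ Re ∈ B ∧ te ∈ B ∧ IsOfFinAddOrder te ∧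
      Me • Pe = (4 : ℤ) • Re + te ∧ c Re + Re = (1 : ℤ) • T := by
  have hT2z : (2 : ℤ) • T = 0 := by exact_mod_cast hT2
  refine ⟨M' * M₁, (m₁ * s * M') • Φ - (2 * m₁ * s * k') • Y', M' • t₁ - (2 * m₁ * s) • t', hM'.mul hM₁,
    B.sub_mem (B.zsmul_mem hΦB _) (B.zsmul_mem hY'B _), B.sub_mem (B.zsmul_mem ht₁B _) (B.zsmul_mem ht'B _), ?_, ?_, ?_⟩
  · rw [← AddCommGroup.mem_torsion] at ht₁ ht' ⊢
    exact sub_mem (AddSubgroup.zsmul_mem _ ht₁ _) (AddSubgroup.zsmul_mem _ ht' _)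
  · -- `M′M₁ P_e = M′(2m₁ Y_e + t₁) = 2m₁ s M′ (2Φ − P′) + M′t₁ = 4(m₁sM′)Φ − 2m₁s(4k′Y′ + t′) + M′t₁`
    have e1 : (M' * M₁) • Pe = M' • ((2 * m₁) • (s • ((2 : ℤ) • Φ - P'))) + M' • t₁ := by
      rw [mul_smul, h1, smul_add, h2]
    have e2 : (2 * m₁ * s * M') • P' = (2 * m₁ * s) • ((4 : ℤ) • (k' • Y') + t') := by
      rw [show (2 * m₁ * s * M') = (2 * m₁ * s) * M' by ring, mul_smul, h4]
    have e3 : M' • ((2 * m₁) • (s • ((2 : ℤ) • Φ - P'))) = (4 * m₁ * s * M') • Φ - (2 * m₁ * s * M') • P' := by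
      module
    rw [e1, e3, e2]
    module
  · rw [map_sub, map_zsmul, map_zsmul]
    have e : (m₁ * s * M') • c Φ - (2 * m₁ * s * k') • c Y' + ((m₁ * s * M') • Φ - (2 * m₁ * s * k') • Y') =
        (m₁ * s * M') • (c Φ + Φ) - (m₁ * s * k') • ((2 : ℤ) • (c Y' + Y')) := by
      module
    rw [e, h3, h5, hT2z, smul_zero, sub_zero, smul_smul, one_zsmul]
    exact zsmul_twoTorsion_of_odd hT2 (((hm₁.mul hs).mul hM').mul hκ')

end Abstract

-- the cell's point-group world over the ring class fields; file-local
attribute [local instance 2000] Classical.propDecidable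

/-! ## §2 The `χ_e` collinearity in `X₀(49)(K[1])` -/

section RelationE

variable {K : Type} [Field K] [NumberField K] {L : Type} [Field L] [NumberField L] [Algebra K L]
  [FiniteDimensional K L] [IsGalois K L]

/-- **`M₁•P_e = (2m₁)•Y_e + t₁`, `M₁, m₁` odd.** Setting of THEOREM A⁗ (type β, `hNo4`): `r_e ∈ L`, `r_e² = −qp`; `P_e` the `χ_e` genus sum of
`y₁`; `Y_e` the partner point `y_{ℚ(√−qp)}` — a `χ_e`-point of infinite order negated by the `σ` with `σ r_e = −r_e` (P2e-2); the height ratio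
`ρ₂ĥ(P_e) = 4ρ₁ĥ(Y_e)` (P2e-1). Granted CLTZ Thm 1.4 (`h14`). [cite: CoatesLiTianZhai2015, Thm. 1.4 and (2.8)] [cite: SilvermanAEC2009, Thm. VIII.9.3] -/
theorem exists_halfTrace_relation_e (h14 : thm14_rankOne_twist) (hK : IsImaginaryQuadratic K) {q p : ℕ} (hq : q.Prime)
    (h3 : 3 < q) (hq4 : q % 4 = 3) (hq7 : jacobiSym q 7 = -1) [Fact p.Prime] (hp8 : p % 8 = 5)
    (hβ : ∃ x : ZMod p, x ^ 4 = -7) (hNo4 : LiLiuTian2024.NoIdealClassOfOrderFour (-((q : ℤ) * p)))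
    (hdK : NumberField.discr K = -(8 * (q : ℤ) * p)) {re : L} (hre : re ^ 2 = algebraMap K L (-((q : K) * p)))
    (y₁ : (cm7.baseChange L).toAffine.Point) (Ye : (cm7.baseChange L).toAffine.Point) (hYent : ¬ IsOfFinAddOrder Ye)
    (hYefix : ∀ σ : L ≃ₐ[K] L, σ re = re → Affine.Point.map (σ : L →ₐ[K] L) Ye = Ye)
    (hYeneg : ∀ σ : L ≃ₐ[K] L, σ re = -re → Affine.Point.map (σ : L →ₐ[K] L) Ye = -Ye)
    {ρ₁ ρ₂ : ℤ} (hρ₁ : Odd ρ₁) (hρ₂ : Odd ρ₂)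
    (hHR : (ρ₂ : ℝ) * Affine.Point.canonicalHeight
        (∑ σ : L ≃ₐ[K] L, (if σ re = re then (1 : ℤ) else -1) • Affine.Point.map (σ : L →ₐ[K] L) y₁) =
      4 * ρ₁ * Affine.Point.canonicalHeight Ye) :
    ∃ (M₁ m₁ : ℤ) (t₁ : (cm7.baseChange L).toAffine.Point), Odd M₁ ∧ Odd m₁ ∧ IsOfFinAddOrder t₁ ∧
      M₁ • (∑ σ : L ≃ₐ[K] L, (if σ re = re then (1 : ℤ) else -1) • Affine.Point.map (σ : L →ₐ[K] L) y₁) = (2 * m₁) • Ye + t₁ := by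
  haveI : (cm7.baseChange L).IsElliptic := by rw [WeierstrassCurve.baseChange]; infer_instance
  have hp : p.Prime := Fact.out
  have hqp0 : ((q : ℚ) * p) ≠ 0 := by have := hq.ne_zero; have := hp.ne_zero; positivity
  have hd0 : (-((q : ℚ) * p)) ≠ 0 := neg_ne_zero.mpr hqp0
  have hqpL : ((q : L) * p) ≠ 0 := by have := hq.ne_zero; have := hp.ne_zero; positivity
  have hr0 : re ≠ 0 := by
    intro h; rw [h, zero_pow two_ne_zero, map_neg, map_mul, map_natCast, map_natCast] at hre
    exact hqpL (neg_eq_zero.mp hre.symm)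
  set Pχ : (cm7.baseChange L).toAffine.Point :=
    ∑ σ : L ≃ₐ[K] L, (if σ re = re then (1 : ℤ) else -1) • Affine.Point.map (σ : L →ₐ[K] L) y₁ with hPχ
  -- the descent data: `d = −qp` is not a square in `K`; rank `V₁(ℚ) = 1`; `V₁^{(d_K)}(ℚ)` torsion
  have hd : ¬ IsSquare (algebraMap ℚ K (-((q : ℚ) * p))) := by
    rw [← neg_mul]; exact not_isSquare_neg_qp_of_discr_negEightTwoPrimes hK hq hp hdK
  have hr' : re ^ 2 = algebraMap K L (algebraMap ℚ K (-((q : ℚ) * p))) := by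
    rw [hre, map_neg (algebraMap ℚ K), map_mul (algebraMap ℚ K), map_natCast, map_natCast]
  haveI := isElliptic_twist_one_cm7 hd0
  have hV : ((cm7.quadraticTwist (-((q : ℚ) * p))).quadraticTwist 1).mordellWeilRank = 1 := by
    haveI := cm7.isElliptic_quadraticTwist hd0
    obtain ⟨W', hE', hmin', C, hC⟩ := exists_isGloballyMinimal_smul_eq_quadraticTwist cm7 hd0
    have h1 : W'.mordellWeilRank = 1 := (rankOne_negTwoPrimesTwist_of_thm14 h14 hq h3 hq4 hq7 hp hp8 hβ hNo4 W' ⟨C, hC⟩).2.1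
    have h2 : (cm7.quadraticTwist (-((q : ℚ) * p))).mordellWeilRank = 1 := by
      have h := mordellWeilRank_variableChange_holds W' C
      unfold mordellWeilRank_variableChange at h
      rw [← hC, h, h1]
    rw [mordellWeilRank_congr (quadraticTwist_quadraticTwist_one_cm7 _), h2]
  have hT : ∀ R : ((cm7.quadraticTwist (-((q : ℚ) * p))).quadraticTwist (NumberField.discr K : ℚ)).toAffine.Point,
      IsOfFinAddOrder R := by
    intro R
    have hc1 : (-((q : ℚ) * p)) = -(((q * p : ℕ) : ℚ)) := by push_cast; ring
    have hc2 : (NumberField.discr K : ℚ) = -(8 * (((q * p : ℕ) : ℚ))) := by rw [hdK]; push_cast; ring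
    have e := Affine.Point.congrEquiv (show (cm7.quadraticTwist (-((q : ℚ) * p))).quadraticTwist (NumberField.discr K : ℚ) =
      (cm7.quadraticTwist (-(((q * p : ℕ) : ℚ)))).quadraticTwist (-(8 * (((q * p : ℕ) : ℚ)))) by rw [hc1, hc2])
    have h := isOfFinAddOrder_point_twist_negPrime_negEight (l := q * p) (mul_ne_zero hq.ne_zero hp.ne_zero) (e R)
    simpa using e.symm.toAddMonoidHom.isOfFinAddOrder h
  have hstep := exists_two_zsmul_sub_of_rank_one_of_twist_torsion hK hd0 hV hT
  obtain ⟨hPfix, hPneg⟩ := isChiPoint_twistedSum (K := K) hre hr0 y₁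
  obtain ⟨a, b, ha, hab⟩ := exists_zsmul_sub_zsmul_isOfFinAddOrder_of_isChiPoint_of_step hd hr' hstep Pχ Ye
    hPfix hPneg hYefix hYeneg hYent
  have hY0 : Affine.Point.canonicalHeight Ye ≠ 0 := fun h0 ↦
    hYent ((Summit.BirchSwinnertonDyer.Uniform.U2.HeegnerHeight.canonicalHeight_eq_zero_iff' Ye).mp h0)
  obtain ⟨M₁, m, t, hM, hm, ht, h4⟩ := exists_odd_zsmul_eq_two_mul_zsmul_add_of_height
    (A := (cm7.baseChange L).toAffine.Point) Affine.Point.canonicalHeight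
    (fun n x ↦ Affine.Point.canonicalHeight_zsmul_holds n x) hY0 ha hab hρ₁ hρ₂ hHR
  exact ⟨M₁, m, t, hM, hm, ht, h4⟩

end RelationE

/-! ## §3 The genus relation of the partner field `F = ℚ(√−qp)` in `X₀(49)(F[1])` -/

section RelationPrime

variable {F : Type} [Field F] [NumberField F] {L : Type} [Field L] [NumberField L] [Algebra F L]
  [FiniteDimensional F L] [IsGalois F L]

/-- **`M′•P′ = 4•(k′•Y′) + t′`, `M′` odd**, for the genus point `P′` of the pair `(p, −q)` of `F = ℚ(√−qp)` over `L = F[1]` (`r² = p`):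
`Y′ = y_{ℚ(√−q)}` — fixed by the `σ` with `σ r = r`, `Y′ + σY′ = T` for `σ r = −r` (A″ partner over `F`), of infinite order; height
`ĥ(P′) = x·ĥ(Y′)`, `x = 0 ∨ ord₂x ≥ 3`, `L(49a1^{(p)},1) = 0 ⇒ x = 0` (P2e-4′); rank inputs of configuration (b): `49a1^{(p)}(ℚ)` torsion when
`L(49a1^{(p)},1) ≠ 0`, `rank (49a1^{(p)})^{(d_F)}(ℚ) = 1`. [cite: CoatesLiTianZhai2015, Thm. 1.3 and (2.8)] [cite: SilvermanAEC2009, Thm. VIII.9.3] -/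
theorem exists_genus_relation_prime (hF : IsImaginaryQuadratic F) {q p : ℕ} (hq : q.Prime) [Fact p.Prime]
    (hdF : NumberField.discr F = -((q : ℤ) * p)) {r : L} (hr : r ^ 2 = algebraMap F L (p : F))
    (y₁ : (cm7.baseChange L).toAffine.Point)
    (Y' : (cm7.baseChange L).toAffine.Point) (hY'nt : ¬ IsOfFinAddOrder Y')
    (hY'fix : ∀ σ : L ≃ₐ[F] L, σ r = r → Affine.Point.map (σ : L →ₐ[F] L) Y' = Y')
    (hY'gal : ∀ σ : L ≃ₐ[F] L, σ r = -r →
      Y' + Affine.Point.map (σ : L →ₐ[F] L) Y' = Affine.Point.some 2 (-1) (nonsingular_cm7_baseChange_two_neg_one L))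
    {x : ℚ} (hx3 : x = 0 ∨ 3 ≤ padicValRat 2 x) (hxL : (cm7.quadraticTwist (p : ℚ)).entireLFunction 1 = 0 → x = 0)
    (hHR : Affine.Point.canonicalHeight
        (∑ σ : L ≃ₐ[F] L, (if σ r = r then (1 : ℤ) else -1) • Affine.Point.map (σ : L →ₐ[F] L) y₁) =
      (x : ℝ) * Affine.Point.canonicalHeight Y')
    (hV0 : (cm7.quadraticTwist (p : ℚ)).entireLFunction 1 ≠ 0 →
      ∀ Q : ((cm7.quadraticTwist (p : ℚ)).quadraticTwist 1).toAffine.Point, IsOfFinAddOrder Q)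
    (hT1 : (haveI := cm7.isElliptic_quadraticTwist (show (p : ℚ) ≠ 0 by exact_mod_cast (Fact.out : p.Prime).ne_zero);
      haveI := (cm7.quadraticTwist (p : ℚ)).isElliptic_quadraticTwist
        (show (NumberField.discr F : ℚ) ≠ 0 by exact_mod_cast NumberField.discr_ne_zero F);
      ((cm7.quadraticTwist (p : ℚ)).quadraticTwist (NumberField.discr F : ℚ)).mordellWeilRank) = 1) :
    ∃ (M' k' : ℤ) (t' : (cm7.baseChange L).toAffine.Point), Odd M' ∧ IsOfFinAddOrder t' ∧
      M' • (∑ σ : L ≃ₐ[F] L, (if σ r = r then (1 : ℤ) else -1) • Affine.Point.map (σ : L →ₐ[F] L) y₁) =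
        (4 : ℤ) • (k' • Y') + t' := by
  haveI : (cm7.baseChange L).IsElliptic := by rw [WeierstrassCurve.baseChange]; infer_instance
  have hp : p.Prime := Fact.out
  have hp0 : (p : ℚ) ≠ 0 := by exact_mod_cast hp.ne_zero
  have hpL : (p : L) ≠ 0 := by exact_mod_cast hp.ne_zero
  have hr0 : r ≠ 0 := by
    intro h; rw [h, zero_pow two_ne_zero, map_natCast] at hr
    exact hpL hr.symm
  set T : (cm7.baseChange L).toAffine.Point := Affine.Point.some 2 (-1) (nonsingular_cm7_baseChange_two_neg_one L) with hT
  set Pχ : (cm7.baseChange L).toAffine.Point :=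
    ∑ σ : L ≃ₐ[F] L, (if σ r = r then (1 : ℤ) else -1) • Affine.Point.map (σ : L →ₐ[F] L) y₁ with hPχ
  have hT2 : T + T = 0 := cm7_twoTorsion_add_self L
  by_cases hPt : IsOfFinAddOrder Pχ
  · exact ⟨1, 0, Pχ, odd_one, hPt, by rw [one_zsmul, zero_zsmul, zsmul_zero, zero_add]⟩
  have hhP : Affine.Point.canonicalHeight Pχ ≠ 0 := fun h0 ↦
    hPt ((Summit.BirchSwinnertonDyer.Uniform.U2.HeegnerHeight.canonicalHeight_eq_zero_iff' Pχ).mp h0)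
  have hx0 : x ≠ 0 := by
    rintro rfl
    apply hhP
    rw [hPχ] at hHR ⊢
    rw [hHR]; simp
  have hL0 : (cm7.quadraticTwist (p : ℚ)).entireLFunction 1 ≠ 0 := fun h ↦ hx0 (hxL h)
  have hv : 3 ≤ padicValRat 2 x := hx3.resolve_left hx0
  -- `2Y′ − T` is a `χ′`-point of infinite order
  have hZ₂nt : ¬ IsOfFinAddOrder ((2 : ℤ) • Y' - T) := by
    intro h
    apply hY'nt
    have h2 : IsOfFinAddOrder ((2 : ℤ) • Y') := by
      have := isOfFinAddOrder_add' h (isOfFinAddOrder_iff_nsmul_eq_zero.mpr ⟨2, two_pos, by rw [two_nsmul, hT2]⟩)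
      rwa [sub_add_cancel] at this
    obtain ⟨n, hn, hn2⟩ := (isOfFinAddOrder_iff_zsmul_eq_zero).mp h2
    exact (isOfFinAddOrder_iff_zsmul_eq_zero).mpr ⟨n * 2, mul_ne_zero hn two_ne_zero, by rw [mul_smul, hn2]⟩
  have hZfix : ∀ σ : L ≃ₐ[F] L, σ r = r → Affine.Point.map (σ : L →ₐ[F] L) ((2 : ℤ) • Y' - T) = (2 : ℤ) • Y' - T := by
    intro σ hσ; rw [map_sub, map_zsmul, hY'fix σ hσ, map_algEquiv_cm7_twoTorsion]
  have hZneg : ∀ σ : L ≃ₐ[F] L, σ r = -r → Affine.Point.map (σ : L →ₐ[F] L) ((2 : ℤ) • Y' - T) = -((2 : ℤ) • Y' - T) := by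
    intro σ hσ
    have hσY : Affine.Point.map (σ : L →ₐ[F] L) Y' = T - Y' := eq_sub_of_add_eq' (hY'gal σ hσ)
    rw [map_sub, map_zsmul, hσY, map_algEquiv_cm7_twoTorsion, ← hT]
    exact sub_eq_zero.mp (by abel)
  -- (RO) in configuration (b) over `F`
  have hd : ¬ IsSquare (algebraMap ℚ F (p : ℚ)) := by
    rw [map_natCast]; exact not_isSquare_natCast_of_discr_negTwoPrimes hF hq hp hdF
  have hr' : r ^ 2 = algebraMap F L (algebraMap ℚ F (p : ℚ)) := by rw [hr, map_natCast, map_natCast, map_natCast]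
  obtain ⟨hPfix, hPneg⟩ := isChiPoint_twistedSum (K := F) hr hr0 y₁
  have hstep := exists_two_zsmul_sub_of_torsion_of_twist_rank_one hF hp0 (hV0 hL0) hT1
  obtain ⟨a, b, ha, hab⟩ := exists_zsmul_sub_zsmul_isOfFinAddOrder_of_isChiPoint_of_step hd hr' hstep Pχ ((2 : ℤ) • Y' - T)
    hPfix hPneg hZfix hZneg hZ₂nt
  have hrel : IsOfFinAddOrder (a • Pχ - (b * 2) • Y') := by
    have e : a • Pχ - (b * 2) • Y' = (a • Pχ - b • ((2 : ℤ) • Y' - T)) - b • T := by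
      rw [smul_sub, mul_smul]; abel
    rw [e]
    refine isOfFinAddOrder_add' hab ?_
    rw [← neg_zsmul]
    exact isOfFinAddOrder_zsmul (-b) (isOfFinAddOrder_iff_nsmul_eq_zero.mpr ⟨2, two_pos, by rw [two_nsmul, hT2]⟩)
  have hY0 : Affine.Point.canonicalHeight Y' ≠ 0 := fun h0 ↦
    hY'nt ((Summit.BirchSwinnertonDyer.Uniform.U2.HeegnerHeight.canonicalHeight_eq_zero_iff' Y').mp h0)
  obtain ⟨M', k, t, hM', ht, h4⟩ := exists_odd_zsmul_eq_four_zsmul_of_height_val_ge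
    (A := (cm7.baseChange L).toAffine.Point) Affine.Point.canonicalHeight
    (fun n x ↦ Affine.Point.canonicalHeight_zsmul_holds n x) hY0 ha hrel hx0 hv hHR
  exact ⟨M', k, t, hM', ht, h4⟩

end RelationPrime

end Summit.BirchSwinnertonDyer.BirchSwinnertonDyer.Theorems.GoldfeldGoodTwists

end
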